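import Summits.HodgeConjecture.HodgeConjecture.Theorems.F0P3cStCharTSJacCartanProduct      -- ★-cand (C8b-product): sandwich continuity, chart images, product map `Ξ` (brings ★ C1–C5, C8a, C8b-core)
import Literature.MeasureTheory.Group.InvariantQuotientSliceMass                            -- ★ (Q1) F0P3a-p06: `measure_eq_quotientMeasure_image_mk_mul_of_slice`, `quotientMeasure_image_mk_ne_zero_ne_top_of_slice`, `measurableSet_image_mk_of_isOpen'`
import HarnessLib

/-!
# F0 · P3c · line LH6 «StCharTS» — WIF antecedent, ELLIPTIC half: brick (C8b-window) «THE PRODUCT WINDOW `c(𝔪_k)·c(𝔱_j)` AND ITS QUOTIENT MASS»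

Cell `pub/hodgecm-mathlib`, crux H413 = `stmt-HodgeConjecture-24833` (lane `--supports … --as helper`); seat LH5-p02 (g6); ROAD «JAC-ELL» v1 §2 steps (2), (5), (6)
(the sub-box window (Q10) folded in), in ★ (C4)'s ABSTRACT frame augmented by complementary additive projections `pM + pT = id` of `V` (`pM` idempotent)
and a subgroup `T ≤ G` LINKED to `ker pM` through the chart (`pM Y = 0 → c Y ∈ T` and `c W ∈ T → pM W = 0` on `Λ 0`).
THEOREMS ONLY; Mathlib + ★ (C1)–(C5), (C8a), (C8b-core), (C8b-product) + ★ (Q1).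

For `j ≥ k` and `A⁰ = {Z ∈ Λ′_k | pT Z ∈ Λ_j}` the window `K′ = c(Ξ(A⁰)) = c(𝔪-part of Λ′_k)·c(𝔱 ∩ Λ_j)`:
* `proj_ids` (projection bookkeeping), `injOn_product`, `image_product_subBox` (`Ξ(Λ′_k) = Λ′_k`), `isOpen_image_product`, `isOpen_window`;
* `slice_window` — the SLICE property `{h ∈ T | x h ∈ K′} = T ∩ c(Λ_j)` at every `x ∈ K′`; `image_mk_window` — `π(K′) = π(c(Λ′_k))`;
* ★ (Q1) ⇒ `measure_window_eq` (`ν(K′) = μ₀(π c(Λ′_k)) · tm(T ∩ c(Λ_j))`), `quotientMeasure_window_ne` (`μ₀(π c(Λ′_k)) ∈ (0, ∞)`);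
  `chart_window_eq` (`κ·ν(K′) = μ(A⁰)`, ★ C1b volume preservation of `Ξ`).

Purpose: the quotient-mass half of the local tube-Jacobian socket (E1b) on the model; consumed by ★-cand `F0P3cStCharTSJacCartanSocketCore`.
HONEST LABEL: count-neutral helper algebra ∕ measure theory; closes no organ; HC_CM is proved only modulo the printed citations (h413 = `stmt-HodgeConjecture-24833`).

## References
* [HarishChandra1970] Harish-Chandra (notes by G. van Dijk), *Harmonic Analysis on Reductive p-adic Groups*, LNM 162 (1970), Lemma 22 (the tube map and
  its Jacobian). Context locator.
* [Serre1992LALG] J.-P. Serre, *Lie Algebras and Lie Groups*, LNM 1500 (1992), Part II Ch. IV §8 (Cayley∕exponential charts), §9 (filtrations). Context locator.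
* [DeitmarEchterhoff2014] A. Deitmar, S. Echterhoff, *Principles of Harmonic Analysis*, 2nd ed., Thm. 1.5.3 (quotient integral formula). Context locator.
-/

set_option autoImplicit false
set_option linter.dupNamespace false

open Set Filter MeasureTheory MeasureTheory.Measure TopologicalSpace Topology Matrix ValuativeRel
open Literature.NumberTheory.Automorphic Literature.NumberTheory.Weil1982.UnitaryFinTopForm Literature.MeasureTheory.Group
open Summit.HodgeConjecture.HodgeConjecture.Cruxes.H413.F0P3cStCharTSCayleyChartHaar
open Summit.HodgeConjecture.HodgeConjecture.Cruxes.H413.F0P3cStCharTSFilteredNewton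
open Summit.HodgeConjecture.HodgeConjecture.Cruxes.H413.F0P3cStCharTSFilteredNewtonHaar
open Summit.HodgeConjecture.HodgeConjecture.Cruxes.H413.F0P3cStCharTSNewtonChartHaar
open Summit.HodgeConjecture.HodgeConjecture.Cruxes.H413.F0P3cStCharTSTwistedTubeCore
open Summit.HodgeConjecture.HodgeConjecture.Cruxes.H413.F0P3cStCharTSJacCartanProduct
open scoped Pointwise Topology ENNReal MatrixGroups

namespace Summit.HodgeConjecture.HodgeConjecture.Cruxes.H413.F0P3cStCharTSJacCartanWindow

/-! ## §3 The product window `K′ = c(Ξ(A⁰))`, `A⁰ = {Z ∈ Λ′_k | pT Z ∈ Λ_j}`: slices, saturation class, masses -/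

section Window

variable {K : Type*} [Field K] [ValuativeRel K] [TopologicalSpace K] [IsNonarchimedeanLocalField K]
  {m : Type*} [Fintype m] [DecidableEq m]
  {V : Type*} [AddCommGroup V] [TopologicalSpace V] [IsTopologicalAddGroup V] [T2Space V]
  {G : Type*} [Group G] [TopologicalSpace G]
  (ι : V →+ Matrix m m K) (Λ : ℕ → AddSubgroup V) {α : ValueGroupWithZero K} (ρ : G →* GL m K) (c : V → G) (σV : V → V → V)
  (pM pT : V →+ V) {Λ' : ℕ → AddSubgroup V} (Ξ : V → V) (T : Subgroup G) {k : ℕ}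

omit [TopologicalSpace V] [IsTopologicalAddGroup V] [T2Space V] in
/-- Bookkeeping of two complementary additive projections (`pM + pT = id`, `pM` idempotent). [cite: Serre1992LALG, Part II Ch. IV §9] -/
theorem proj_ids (hsum : ∀ Z, pM Z + pT Z = Z) (hidem : ∀ Z, pM (pM Z) = pM Z) (Z : V) :
    pT Z = Z - pM Z ∧ pM (pT Z) = 0 ∧ pT (pM Z) = 0 ∧ pT (pT Z) = pT Z ∧ (pM Z = 0 → pT Z = Z) := by
  have h1 : pT Z = Z - pM Z := by rw [eq_sub_iff_add_eq, add_comm, hsum]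
  have h2 : pM (pT Z) = 0 := by rw [h1, map_sub, hidem, sub_self]
  have h3 : pT (pM Z) = 0 := by
    have := hsum (pM Z); rw [hidem] at this
    simpa using this
  refine ⟨h1, h2, h3, ?_, fun h0 => by rw [h1, h0, sub_zero]⟩
  have := hsum (pT Z); rw [h2, zero_add] at this; exact this

omit [IsTopologicalAddGroup V] in
/-- **`Ξ` is injective on the sub-box `Λ′ k`** (★ C1 `injOn_of_newton`). [cite: Serre1992LALG, Part II Ch. IV §8] -/
theorem injOn_product (hι : IsClosedEmbedding ι) (hΛ : ∀ j X, X ∈ Λ j ↔ ValBound (α ^ (j + 1)) (ι X)) (hα1 : α < 1)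
    (hΛ' : ∀ j Z, Z ∈ Λ' j ↔ (pM Z ∈ Λ j ∧ pT Z ∈ Λ j)) (hsum : ∀ Z, pM Z + pT Z = Z)
    (hshift : ∀ j, ∀ Z ∈ Λ (j + k), pM Z ∈ Λ j ∧ pT Z ∈ Λ j)
    (hΞ : ∀ Z ∈ Λ' k, ι (Ξ Z) = (1 - ι (pM Z))⁻¹ * (ι (pM Z) + ι (pT Z)) * (1 + ι (pM Z) * ι (pT Z))⁻¹ * (1 - ι (pM Z))) :
    InjOn Ξ (Λ' k : Set V) :=
  injOn_of_newton Λ' Ξ (subBox_antitone hΛ' (level_antitone ι Λ hΛ hα1.le)) (subBox_basis hΛ' hsum (exists_level_subset_of_mem_nhds ι Λ hι hΛ hα1))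
    (product_newton ι Λ pM pT Ξ hΛ hα1 hΛ' hsum hshift hΞ)

/-- **`Ξ(Λ′ k) = Λ′ k`** (★ C1 `image_coe_eq_of_newton`). [cite: Serre1992LALG, Part II Ch. IV §8] -/
theorem image_product_subBox (hι : IsClosedEmbedding ι) (hΛ : ∀ j X, X ∈ Λ j ↔ ValBound (α ^ (j + 1)) (ι X)) (hα : α ≠ 0) (hα1 : α < 1)
    (hΛ' : ∀ j Z, Z ∈ Λ' j ↔ (pM Z ∈ Λ j ∧ pT Z ∈ Λ j)) (hsum : ∀ Z, pM Z + pT Z = Z) (hpMc : Continuous pM) (hpTc : Continuous pT)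
    (hshift : ∀ j, ∀ Z ∈ Λ (j + k), pM Z ∈ Λ j ∧ pT Z ∈ Λ j)
    (hΞ : ∀ Z ∈ Λ' k, ι (Ξ Z) = (1 - ι (pM Z))⁻¹ * (ι (pM Z) + ι (pT Z)) * (1 + ι (pM Z) * ι (pT Z))⁻¹ * (1 - ι (pM Z))) :
    Ξ '' (Λ' k : Set V) = (Λ' k : Set V) := by
  have hopenΛ := isOpen_level ι Λ hι.continuous hΛ hα
  exact image_coe_eq_of_newton Λ' Ξ (subBox_antitone hΛ' (level_antitone ι Λ hΛ hα1.le)) (isOpen_subBox hΛ' hopenΛ hshift)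
    (isCompact_subBox hΛ' hopenΛ (isCompact_level ι Λ hι hΛ) hshift hsum k) (subBox_basis hΛ' hsum (exists_level_subset_of_mem_nhds ι Λ hι hΛ hα1))
    (continuousOn_product ι Λ pM pT Ξ hι hΛ hα1 hΛ' hpMc hpTc hΞ) (product_newton ι Λ pM pT Ξ hΛ hα1 hΛ' hsum hshift hΞ)
    (by rw [product_zero ι pM pT Ξ hι.injective hΞ]; exact zero_mem _)

/-- **`Ξ(A⁰)` is open** for `A⁰ = {Z ∈ Λ′_k | pT Z ∈ Λ_j}`, `j ≥ k`: `A⁰` is a union of `Λ′_j`-cosets and `Ξ` maps cosets onto cosets. [cite: Serre1992LALG, Part II Ch. IV §8] -/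
theorem isOpen_image_product (hι : IsClosedEmbedding ι) (hΛ : ∀ j X, X ∈ Λ j ↔ ValBound (α ^ (j + 1)) (ι X)) (hα : α ≠ 0) (hα1 : α < 1)
    (hΛ' : ∀ j Z, Z ∈ Λ' j ↔ (pM Z ∈ Λ j ∧ pT Z ∈ Λ j)) (hsum : ∀ Z, pM Z + pT Z = Z) (hpMc : Continuous pM) (hpTc : Continuous pT)
    (hshift : ∀ j, ∀ Z ∈ Λ (j + k), pM Z ∈ Λ j ∧ pT Z ∈ Λ j)
    (hΞ : ∀ Z ∈ Λ' k, ι (Ξ Z) = (1 - ι (pM Z))⁻¹ * (ι (pM Z) + ι (pT Z)) * (1 + ι (pM Z) * ι (pT Z))⁻¹ * (1 - ι (pM Z)))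
    {j : ℕ} (hj : k ≤ j) : IsOpen (Ξ '' ((Λ' k : Set V) ∩ pT ⁻¹' (Λ j : Set V))) := by
  have hanti := level_antitone ι Λ hΛ hα1.le
  have hanti' : Antitone Λ' := subBox_antitone hΛ' hanti
  have hopenΛ := isOpen_level ι Λ hι.continuous hΛ hα
  have hopen' := isOpen_subBox hΛ' hopenΛ hshift
  set A := (Λ' k : Set V) ∩ pT ⁻¹' (Λ j : Set V) with hA
  have hcos : ∀ Z ∈ A, Z +ᵥ (Λ' j : Set V) ⊆ A := by
    rintro Z ⟨hZk, hZj⟩ _ ⟨y, hy, rfl⟩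
    refine ⟨add_mem hZk (hanti' hj hy), ?_⟩
    show pT (Z + y) ∈ (Λ j : Set V)
    rw [map_add]
    exact add_mem hZj ((hΛ' j y).1 hy).2
  have hunion : Ξ '' A = ⋃ Z ∈ A, Ξ '' (Z +ᵥ (Λ' j : Set V)) := by
    apply Subset.antisymm
    · rintro _ ⟨Z, hZ, rfl⟩
      exact mem_iUnion₂.2 ⟨Z, hZ, ⟨Z, by simpa using (zero_mem (Λ' j) : (0 : V) ∈ Λ' j) |> fun h => ⟨0, h, by simp⟩, rfl⟩⟩
    · exact iUnion₂_subset fun Z hZ => image_mono (hcos Z hZ)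
  rw [hunion]
  refine isOpen_biUnion fun Z hZ => ?_
  rw [image_vadd_eq_of_newton Λ' Ξ hanti' hopen' (isCompact_subBox hΛ' hopenΛ (isCompact_level ι Λ hι hΛ) hshift hsum k)
    (subBox_basis hΛ' hsum (exists_level_subset_of_mem_nhds ι Λ hι hΛ hα1)) (continuousOn_product ι Λ pM pT Ξ hι hΛ hα1 hΛ' hpMc hpTc hΞ)
    (product_newton ι Λ pM pT Ξ hΛ hα1 hΛ' hsum hshift hΞ) hj hZ.1]
  exact (hopen' j).vadd _

variable [IsTopologicalGroup G]

omit [TopologicalSpace V] [IsTopologicalAddGroup V] [T2Space V] [TopologicalSpace G] [IsTopologicalGroup G] in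
/-- Chart points of `T` inside a subset of the base box are the chart points of its `ker pM`-part. [cite: HarishChandra1970, Lemma 22] -/
theorem image_inter_coe_eq (hcT : ∀ Y ∈ Λ 0, pM Y = 0 → c Y ∈ T) (hTc : ∀ W ∈ Λ 0, c W ∈ T → pM W = 0) {A : Set V} (hA : A ⊆ (Λ 0 : Set V)) :
    c '' A ∩ (T : Set G) = c '' (A ∩ {Y | pM Y = 0}) := by
  ext g; constructor
  · rintro ⟨⟨Y, hY, rfl⟩, hg⟩
    exact ⟨Y, ⟨hY, hTc Y (hA hY) hg⟩, rfl⟩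
  · rintro ⟨Y, ⟨hY, hY0⟩, rfl⟩
    exact ⟨⟨Y, hY, rfl⟩, hcT Y (hA hY) hY0⟩

omit [TopologicalSpace G] [IsTopologicalGroup G] in
/-- **THE SLICE PROPERTY OF THE PRODUCT WINDOW**: for `x ∈ K′ = c(Ξ(A⁰))`, `{h ∈ T | x·h ∈ K′} = T ∩ c(Λ_j)`. [cite: HarishChandra1970, Lemma 22]
[cite: DeitmarEchterhoff2014, Thm. 1.5.3] -/
theorem slice_window (hι : IsClosedEmbedding ι) (hΛ : ∀ j X, X ∈ Λ j ↔ ValBound (α ^ (j + 1)) (ι X)) (hα : α ≠ 0) (hα1 : α < 1) (h2 : (2 : K) ≠ 0)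
    (hρinj : Function.Injective ρ) (hc : ∀ X ∈ Λ 0, ((ρ (c X) : GL m K) : Matrix m m K) = cayley (ι X))
    (hσ : ∀ W ∈ Λ 0, ∀ X ∈ Λ 0, ι (σV W X) = (1 - ι W)⁻¹ * (ι W + ι X) * (1 + ι W * ι X)⁻¹ * (1 - ι W))
    (hσc : ∀ W ∈ Λ 0, ContinuousOn (σV W) (Λ 0 : Set V))
    (hΛ' : ∀ j Z, Z ∈ Λ' j ↔ (pM Z ∈ Λ j ∧ pT Z ∈ Λ j)) (hsum : ∀ Z, pM Z + pT Z = Z) (hidem : ∀ Z, pM (pM Z) = pM Z)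
    (hshift : ∀ j, ∀ Z ∈ Λ (j + k), pM Z ∈ Λ j ∧ pT Z ∈ Λ j)
    (hΞ : ∀ Z ∈ Λ' k, ι (Ξ Z) = (1 - ι (pM Z))⁻¹ * (ι (pM Z) + ι (pT Z)) * (1 + ι (pM Z) * ι (pT Z))⁻¹ * (1 - ι (pM Z)))
    (hcT : ∀ Y ∈ Λ 0, pM Y = 0 → c Y ∈ T) (hTc : ∀ W ∈ Λ 0, c W ∈ T → pM W = 0)
    {j : ℕ} (hj : k ≤ j) {x : G} (hx : x ∈ c '' (Ξ '' ((Λ' k : Set V) ∩ pT ⁻¹' (Λ j : Set V)))) :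
    {h : ↥T | x * (h : G) ∈ c '' (Ξ '' ((Λ' k : Set V) ∩ pT ⁻¹' (Λ j : Set V)))} = {h : ↥T | (h : G) ∈ c '' (Λ j : Set V)} := by
  have hanti := level_antitone ι Λ hΛ hα1.le
  have hk0 : Λ k ≤ Λ 0 := hanti (Nat.zero_le k)
  have hj0 : Λ j ≤ Λ 0 := hanti (Nat.zero_le j)
  have hjk : Λ j ≤ Λ k := hanti hj
  have hmul : ∀ {j : ℕ} {W X : V}, W ∈ Λ j → X ∈ Λ j → c W * c X ∈ c '' (Λ j : Set V) := fun hW hX =>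
    mul_mem_image_level ι Λ ρ c σV hι hΛ hα hα1 h2 hρinj hc hσ hσc hW hX
  have hΞmem : ∀ Z ∈ Λ' k, Ξ Z ∈ Λ 0 := fun Z hZ => hk0 (product_mem_level ι Λ pM pT Ξ hΛ hα1 hΛ' hΞ hZ)
  have hΞc : ∀ Z ∈ Λ' k, c (Ξ Z) = c (pM Z) * c (pT Z) := fun Z hZ => chart_product ι Λ ρ c pM pT Ξ hΛ hα1 hρinj hc hΛ' hΞ hΞmem hZ
  have hP := proj_ids pM pT hsum hidem
  -- the centre `x = c (pM Z) * c (pT Z)`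
  obtain ⟨_, ⟨Z, ⟨hZk, hZj⟩, rfl⟩, rfl⟩ := hx
  have hZj' : pT Z ∈ Λ j := hZj
  obtain ⟨hZM, hZT⟩ := (hΛ' k Z).1 hZk
  have hcT_Z : c (pT Z) ∈ T := hcT _ (hk0 hZT) (hP Z).2.1
  ext h
  simp only [mem_setOf_eq]
  constructor
  · rintro ⟨_, ⟨Z', ⟨hZ'k, hZ'j⟩, rfl⟩, hEq⟩
    have hZ'j' : pT Z' ∈ Λ j := hZ'j
    obtain ⟨hZ'M, hZ'T⟩ := (hΛ' k Z').1 hZ'k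
    rw [hΞc Z hZk, hΞc Z' hZ'k] at hEq
    -- `(c (pM Z))⁻¹ * c (pM Z') = c (pT Z) * h * (c (pT Z'))⁻¹ ∈ c(Λ k) ∩ T`
    have hq : (c (pM Z))⁻¹ * c (pM Z') = c (pT Z) * (h : G) * (c (pT Z'))⁻¹ := by
      rw [inv_mul_eq_iff_eq_mul, ← mul_assoc, ← mul_assoc, ← hEq, mul_inv_cancel_right]
    obtain ⟨W, hW, hWeq⟩ := inv_mul_mem_image_level ι Λ ρ c hΛ hα1 hρinj hc hmul hZM hZ'M
    have hWT : c W ∈ T := by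
      rw [hWeq, hq]
      exact T.mul_mem (T.mul_mem hcT_Z h.2) (T.inv_mem (hcT _ (hk0 hZ'T) (hP Z').2.1))
    have hW0 : pM W = 0 := hTc W (hk0 hW) hWT
    -- `Z₃ = pM Z + W` and `pM Z'` have the same `Ξ`-image under `c`
    have hZ₃ : pM Z + W ∈ Λ' k := (hΛ' k _).2 ⟨by rw [map_add, hidem, hW0, add_zero]; exact hZM,
      by rw [map_add, (hP Z).2.2.1, zero_add, (hP W).2.2.2.2 hW0]; exact hW⟩
    have hZ'' : pM Z' ∈ Λ' k := (hΛ' k _).2 ⟨by rw [hidem]; exact hZ'M, by rw [(hP Z').2.2.1]; exact zero_mem _⟩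
    have hEq2 : c (Ξ (pM Z + W)) = c (Ξ (pM Z')) := by
      rw [hΞc _ hZ₃, hΞc _ hZ'', map_add, hidem, hW0, add_zero, map_add, (hP Z).2.2.1, zero_add, (hP W).2.2.2.2 hW0, hWeq,
        mul_inv_cancel_left, (hP Z').2.2.1, chart_zero ι Λ ρ c hρinj hc, mul_one, hidem]
    have hEq3 : pM Z + W = pM Z' :=
      injOn_product ι Λ pM pT Ξ hι hΛ hα1 hΛ' hsum hshift hΞ hZ₃ hZ''
        (injOn_chart ι Λ ρ c h2 hι.injective hΛ hα1 hc (hΞmem _ hZ₃) (hΞmem _ hZ'') hEq2)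
    have hWz : W = 0 := by
      have := congrArg pT hEq3
      rwa [map_add, (hP Z).2.2.1, zero_add, (hP W).2.2.2.2 hW0, (hP Z').2.2.1] at this
    rw [hWz, chart_zero ι Λ ρ c hρinj hc] at hWeq
    have hh : (h : G) = (c (pT Z))⁻¹ * c (pT Z') := by
      rw [eq_inv_mul_iff_mul_eq]
      exact mul_inv_eq_one.1 (by rw [← hq, ← hWeq])
    rw [hh]
    exact inv_mul_mem_image_level ι Λ ρ c hΛ hα1 hρinj hc hmul hZj' hZ'j'
  · rintro ⟨W, hW, hWeq⟩
    obtain ⟨W₂, hW₂, hW₂eq⟩ := hmul hZj' hW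
    have hW₂T : c W₂ ∈ T := by rw [hW₂eq, hWeq]; exact T.mul_mem hcT_Z h.2
    have hW₂0 : pM W₂ = 0 := hTc W₂ (hj0 hW₂) hW₂T
    have hZ₂ : pM Z + W₂ ∈ Λ' k ∧ pT (pM Z + W₂) ∈ Λ j := by
      refine ⟨(hΛ' k _).2 ⟨by rw [map_add, hidem, hW₂0, add_zero]; exact hZM, ?_⟩, ?_⟩ <;>
        rw [map_add, (hP Z).2.2.1, zero_add, (hP W₂).2.2.2.2 hW₂0]
      · exact hjk hW₂
      · exact hW₂
    refine ⟨Ξ (pM Z + W₂), ⟨pM Z + W₂, ⟨hZ₂.1, hZ₂.2⟩, rfl⟩, ?_⟩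
    rw [hΞc _ hZ₂.1, hΞc Z hZk, map_add, hidem, hW₂0, add_zero, map_add, (hP Z).2.2.1, zero_add, (hP W₂).2.2.2.2 hW₂0, hW₂eq, hWeq,
      mul_assoc]

omit [TopologicalSpace G] [IsTopologicalGroup G] in
/-- **The `T`-saturation class of the window is `π(c(Λ′ k))`**: `π(K′) = π(c(Λ′_k))`. [cite: HarishChandra1970, Lemma 22] -/
theorem image_mk_window (hι : IsClosedEmbedding ι) (hΛ : ∀ j X, X ∈ Λ j ↔ ValBound (α ^ (j + 1)) (ι X)) (hα : α ≠ 0) (hα1 : α < 1)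
    (hρinj : Function.Injective ρ) (hc : ∀ X ∈ Λ 0, ((ρ (c X) : GL m K) : Matrix m m K) = cayley (ι X))
    (hΛ' : ∀ j Z, Z ∈ Λ' j ↔ (pM Z ∈ Λ j ∧ pT Z ∈ Λ j)) (hsum : ∀ Z, pM Z + pT Z = Z) (hidem : ∀ Z, pM (pM Z) = pM Z)
    (hpMc : Continuous pM) (hpTc : Continuous pT)
    (hshift : ∀ j, ∀ Z ∈ Λ (j + k), pM Z ∈ Λ j ∧ pT Z ∈ Λ j)
    (hΞ : ∀ Z ∈ Λ' k, ι (Ξ Z) = (1 - ι (pM Z))⁻¹ * (ι (pM Z) + ι (pT Z)) * (1 + ι (pM Z) * ι (pT Z))⁻¹ * (1 - ι (pM Z)))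
    (hcT : ∀ Y ∈ Λ 0, pM Y = 0 → c Y ∈ T) (j : ℕ) :
    (QuotientGroup.mk : G → G ⧸ T) '' (c '' (Ξ '' ((Λ' k : Set V) ∩ pT ⁻¹' (Λ j : Set V)))) = (QuotientGroup.mk : G → G ⧸ T) '' (c '' (Λ' k : Set V)) := by
  have hanti := level_antitone ι Λ hΛ hα1.le
  have hk0 : Λ k ≤ Λ 0 := hanti (Nat.zero_le k)
  have hΞmem : ∀ Z ∈ Λ' k, Ξ Z ∈ Λ 0 := fun Z hZ => hk0 (product_mem_level ι Λ pM pT Ξ hΛ hα1 hΛ' hΞ hZ)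
  have hΞc : ∀ Z ∈ Λ' k, c (Ξ Z) = c (pM Z) * c (pT Z) := fun Z hZ => chart_product ι Λ ρ c pM pT Ξ hΛ hα1 hρinj hc hΛ' hΞ hΞmem hZ
  have hP := proj_ids pM pT hsum hidem
  have himg := image_product_subBox ι Λ pM pT Ξ hι hΛ hα hα1 hΛ' hsum hpMc hpTc hshift hΞ
  apply Subset.antisymm
  · exact image_mono (image_mono ((image_mono inter_subset_left).trans himg.le))
  · rintro _ ⟨_, ⟨Z, hZ, rfl⟩, rfl⟩
    have hZ' : Z ∈ Ξ '' (Λ' k : Set V) := by rw [himg]; exact hZ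
    obtain ⟨Z₁, hZ₁, rfl⟩ := hZ'
    obtain ⟨hZ₁M, hZ₁T⟩ := (hΛ' k Z₁).1 hZ₁
    have hZ₂ : pM Z₁ ∈ (Λ' k : Set V) ∩ pT ⁻¹' (Λ j : Set V) :=
      ⟨(hΛ' k _).2 ⟨by rw [hidem]; exact hZ₁M, by rw [(hP Z₁).2.2.1]; exact zero_mem _⟩, by show pT (pM Z₁) ∈ (Λ j : Set V); rw [(hP Z₁).2.2.1]; exact zero_mem _⟩
    refine ⟨c (Ξ (pM Z₁)), ⟨Ξ (pM Z₁), ⟨pM Z₁, hZ₂, rfl⟩, rfl⟩, ?_⟩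
    rw [hΞc _ hZ₂.1, hΞc _ hZ₁, hidem, (hP Z₁).2.2.1, chart_zero ι Λ ρ c hρinj hc, mul_one]
    exact (QuotientGroup.mk_mul_of_mem (c (pM Z₁)) (hcT _ (hk0 hZ₁T) (hP Z₁).2.1)).symm

omit [IsTopologicalGroup G] in
/-- **The window `K′ = c(Ξ(A⁰))` is open** (and so is `c(A)` for every open `A ⊆ Λ 0`). [cite: Serre1992LALG, Part II Ch. IV §8] -/
theorem isOpen_window [T2Space G] (hι : IsClosedEmbedding ι) (hΛ : ∀ j X, X ∈ Λ j ↔ ValBound (α ^ (j + 1)) (ι X)) (hα : α ≠ 0) (hα1 : α < 1) (h2 : (2 : K) ≠ 0)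
    (hc : ∀ X ∈ Λ 0, ((ρ (c X) : GL m K) : Matrix m m K) = cayley (ι X)) (hcc : ContinuousOn c (Λ 0 : Set V)) (hK0 : IsOpen (c '' (Λ 0 : Set V)))
    (hΛ' : ∀ j Z, Z ∈ Λ' j ↔ (pM Z ∈ Λ j ∧ pT Z ∈ Λ j)) (hsum : ∀ Z, pM Z + pT Z = Z) (hpMc : Continuous pM) (hpTc : Continuous pT)
    (hshift : ∀ j, ∀ Z ∈ Λ (j + k), pM Z ∈ Λ j ∧ pT Z ∈ Λ j)
    (hΞ : ∀ Z ∈ Λ' k, ι (Ξ Z) = (1 - ι (pM Z))⁻¹ * (ι (pM Z) + ι (pT Z)) * (1 + ι (pM Z) * ι (pT Z))⁻¹ * (1 - ι (pM Z)))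
    {j : ℕ} (hj : k ≤ j) : IsOpen (c '' (Ξ '' ((Λ' k : Set V) ∩ pT ⁻¹' (Λ j : Set V)))) :=
  isOpen_image_of_subset c hcc (injOn_chart ι Λ ρ c h2 hι.injective hΛ hα1 hc) (isCompact_level ι Λ hι hΛ 0) hK0
    (isOpen_image_product ι Λ pM pT Ξ hι hΛ hα hα1 hΛ' hsum hpMc hpTc hshift hΞ hj)
    (by rintro _ ⟨Z, hZ, rfl⟩; exact level_antitone ι Λ hΛ hα1.le (Nat.zero_le k) (product_mem_level ι Λ pM pT Ξ hΛ hα1 hΛ' hΞ hZ.1))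

variable [T2Space G] [LocallyCompactSpace G] [SecondCountableTopology G] [MeasurableSpace G] [BorelSpace G]
  [MeasurableSpace (G ⧸ T)] [BorelSpace (G ⧸ T)]
  (ν : Measure G) [ν.IsHaarMeasure] [ν.IsMulRightInvariant]
  (tm : Measure ↥T) [tm.IsMulLeftInvariant] [IsFiniteMeasureOnCompacts tm] [tm.IsOpenPosMeasure] [tm.IsInvInvariant] [SFinite tm]

/-- **MASS OF THE WINDOW** (★ Q1): `ν(K′) = μ₀(π c(Λ′_k)) · tm(T ∩ c(Λ_j))`, `μ₀ = quotientMeasure T tm _ ν`. [cite: DeitmarEchterhoff2014, Thm. 1.5.3]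
[cite: HarishChandra1970, Lemma 22] -/
theorem measure_window_eq (hTcl : IsClosed (T : Set G)) (hι : IsClosedEmbedding ι) (hΛ : ∀ j X, X ∈ Λ j ↔ ValBound (α ^ (j + 1)) (ι X)) (hα : α ≠ 0) (hα1 : α < 1)
    (h2 : (2 : K) ≠ 0) (hρinj : Function.Injective ρ) (hc : ∀ X ∈ Λ 0, ((ρ (c X) : GL m K) : Matrix m m K) = cayley (ι X))
    (hcc : ContinuousOn c (Λ 0 : Set V)) (hK0 : IsOpen (c '' (Λ 0 : Set V)))
    (hσ : ∀ W ∈ Λ 0, ∀ X ∈ Λ 0, ι (σV W X) = (1 - ι W)⁻¹ * (ι W + ι X) * (1 + ι W * ι X)⁻¹ * (1 - ι W))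
    (hσc : ∀ W ∈ Λ 0, ContinuousOn (σV W) (Λ 0 : Set V))
    (hΛ' : ∀ j Z, Z ∈ Λ' j ↔ (pM Z ∈ Λ j ∧ pT Z ∈ Λ j)) (hsum : ∀ Z, pM Z + pT Z = Z) (hidem : ∀ Z, pM (pM Z) = pM Z)
    (hpMc : Continuous pM) (hpTc : Continuous pT) (hshift : ∀ j, ∀ Z ∈ Λ (j + k), pM Z ∈ Λ j ∧ pT Z ∈ Λ j)
    (hΞ : ∀ Z ∈ Λ' k, ι (Ξ Z) = (1 - ι (pM Z))⁻¹ * (ι (pM Z) + ι (pT Z)) * (1 + ι (pM Z) * ι (pT Z))⁻¹ * (1 - ι (pM Z)))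
    (hcT : ∀ Y ∈ Λ 0, pM Y = 0 → c Y ∈ T) (hTc : ∀ W ∈ Λ 0, c W ∈ T → pM W = 0) {j : ℕ} (hj : k ≤ j) :
    ν (c '' (Ξ '' ((Λ' k : Set V) ∩ pT ⁻¹' (Λ j : Set V)))) =
      quotientMeasure T tm hTcl ν ((QuotientGroup.mk : G → G ⧸ T) '' (c '' (Λ' k : Set V))) * tm {h : ↥T | (h : G) ∈ c '' (Λ j : Set V)} := by
  haveI : IsClosed (T : Set G) := hTcl
  have hopen := isOpen_window ι Λ ρ c pM pT Ξ hι hΛ hα hα1 h2 hc hcc hK0 hΛ' hsum hpMc hpTc hshift hΞ hj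
  rw [← image_mk_window ι Λ ρ c pM pT Ξ T hι hΛ hα hα1 hρinj hc hΛ' hsum hidem hpMc hpTc hshift hΞ hcT j]
  refine measure_eq_quotientMeasure_image_mk_mul_of_slice T tm ν hopen.measurableSet (measurableSet_image_mk_of_isOpen' T hopen) ?_
    (fun x hx => slice_window ι Λ ρ c σV pM pT Ξ T hι hΛ hα hα1 h2 hρinj hc hσ hσc hΛ' hsum hidem hshift hΞ hcT hTc hj hx)
  exact (isOpen_image_of_subset c hcc (injOn_chart ι Λ ρ c h2 hι.injective hΛ hα1 hc) (isCompact_level ι Λ hι hΛ 0) hK0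
    (isOpen_level ι Λ hι.continuous hΛ hα j) (level_antitone ι Λ hΛ hα1.le (Nat.zero_le j))).preimage continuous_subtype_val |>.measurableSet

/-- **THE QUOTIENT MASS OF `π c(Λ′_k)` IS POSITIVE AND FINITE** (★ Q1, slices of the window at `j = k`). [cite: DeitmarEchterhoff2014, Thm. 1.5.3] -/
theorem quotientMeasure_window_ne (hTcl : IsClosed (T : Set G)) (hι : IsClosedEmbedding ι) (hΛ : ∀ j X, X ∈ Λ j ↔ ValBound (α ^ (j + 1)) (ι X)) (hα : α ≠ 0)
    (hα1 : α < 1) (h2 : (2 : K) ≠ 0) (hρinj : Function.Injective ρ) (hc : ∀ X ∈ Λ 0, ((ρ (c X) : GL m K) : Matrix m m K) = cayley (ι X))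
    (hcc : ContinuousOn c (Λ 0 : Set V)) (hK0 : IsOpen (c '' (Λ 0 : Set V)))
    (hσ : ∀ W ∈ Λ 0, ∀ X ∈ Λ 0, ι (σV W X) = (1 - ι W)⁻¹ * (ι W + ι X) * (1 + ι W * ι X)⁻¹ * (1 - ι W))
    (hσc : ∀ W ∈ Λ 0, ContinuousOn (σV W) (Λ 0 : Set V))
    (hΛ' : ∀ j Z, Z ∈ Λ' j ↔ (pM Z ∈ Λ j ∧ pT Z ∈ Λ j)) (hsum : ∀ Z, pM Z + pT Z = Z) (hidem : ∀ Z, pM (pM Z) = pM Z)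
    (hpMc : Continuous pM) (hpTc : Continuous pT) (hshift : ∀ j, ∀ Z ∈ Λ (j + k), pM Z ∈ Λ j ∧ pT Z ∈ Λ j)
    (hΞ : ∀ Z ∈ Λ' k, ι (Ξ Z) = (1 - ι (pM Z))⁻¹ * (ι (pM Z) + ι (pT Z)) * (1 + ι (pM Z) * ι (pT Z))⁻¹ * (1 - ι (pM Z)))
    (hcT : ∀ Y ∈ Λ 0, pM Y = 0 → c Y ∈ T) (hTc : ∀ W ∈ Λ 0, c W ∈ T → pM W = 0) :
    quotientMeasure T tm hTcl ν ((QuotientGroup.mk : G → G ⧸ T) '' (c '' (Λ' k : Set V))) ≠ 0 ∧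
      quotientMeasure T tm hTcl ν ((QuotientGroup.mk : G → G ⧸ T) '' (c '' (Λ' k : Set V))) ≠ ∞ := by
  haveI : IsClosed (T : Set G) := hTcl
  have hanti := level_antitone ι Λ hΛ hα1.le
  have hopen := isOpen_window ι Λ ρ c pM pT Ξ hι hΛ hα hα1 h2 hc hcc hK0 hΛ' hsum hpMc hpTc hshift hΞ le_rfl
  have hinj := injOn_chart ι Λ ρ c h2 hι.injective hΛ hα1 hc
  have hopenk : IsOpen (c '' (Λ k : Set V)) :=
    isOpen_image_of_subset c hcc hinj (isCompact_level ι Λ hι hΛ 0) hK0 (isOpen_level ι Λ hι.continuous hΛ hα k) (hanti (Nat.zero_le k))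
  rw [← image_mk_window ι Λ ρ c pM pT Ξ T hι hΛ hα hα1 hρinj hc hΛ' hsum hidem hpMc hpTc hshift hΞ hcT k]
  have h0mem : (0 : V) ∈ (Λ' k : Set V) ∩ pT ⁻¹' (Λ k : Set V) := ⟨zero_mem _, by show pT 0 ∈ (Λ k : Set V); rw [map_zero]; exact zero_mem _⟩
  have h1K : (1 : G) ∈ c '' (Ξ '' ((Λ' k : Set V) ∩ pT ⁻¹' (Λ k : Set V))) :=
    ⟨Ξ 0, ⟨0, h0mem, rfl⟩, by rw [product_zero ι pM pT Ξ hι.injective hΞ, chart_zero ι Λ ρ c hρinj hc]⟩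
  have hsub0 : c '' (Ξ '' ((Λ' k : Set V) ∩ pT ⁻¹' (Λ k : Set V))) ⊆ c '' (Λ 0 : Set V) := by
    rintro _ ⟨_, ⟨Z, hZ, rfl⟩, rfl⟩
    exact ⟨Ξ Z, hanti (Nat.zero_le k) (product_mem_level ι Λ pM pT Ξ hΛ hα1 hΛ' hΞ hZ.1), rfl⟩
  have hcomp0 : IsCompact (c '' (Λ 0 : Set V)) := (isCompact_level ι Λ hι hΛ 0).image_of_continuousOn hcc
  refine quotientMeasure_image_mk_ne_zero_ne_top_of_slice T tm ν hopen.measurableSet (measurableSet_image_mk_of_isOpen' T hopen)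
    (hopenk.preimage continuous_subtype_val).measurableSet
    (fun x hx => slice_window ι Λ ρ c σV pM pT Ξ T hι hΛ hα hα1 h2 hρinj hc hσ hσc hΛ' hsum hidem hshift hΞ hcT hTc le_rfl hx)
    (hopen.measure_ne_zero ν ⟨1, h1K⟩) (measure_mono hsub0 |>.trans_lt hcomp0.measure_lt_top).ne
    ((hopenk.preimage continuous_subtype_val).measure_ne_zero tm ⟨1, (⟨0, zero_mem _, chart_zero ι Λ ρ c hρinj hc⟩ : ((1 : ↥T) : G) ∈ c '' (Λ k : Set V))⟩)
    (IsCompact.measure_lt_top ?_).ne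
  exact hTcl.isClosedEmbedding_subtypeVal.isCompact_preimage ((isCompact_level ι Λ hι hΛ k).image_of_continuousOn (hcc.mono (hanti (Nat.zero_le k))))

omit [IsTopologicalGroup G] [LocallyCompactSpace G] [SecondCountableTopology G] [ν.IsHaarMeasure] [ν.IsMulRightInvariant] in
/-- **CHART MASS OF THE WINDOW**: `κ · ν(K′) = μ(A⁰)` — the chart identity on `Λ 0` and volume preservation of `Ξ` (★ C1b). [cite: HarishChandra1970, Lemma 22] -/
theorem chart_window_eq [SecondCountableTopology V] [LocallyCompactSpace V] [MeasurableSpace V] [BorelSpace V] (μ : Measure V) [μ.IsAddHaarMeasure]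
    (hι : IsClosedEmbedding ι) (hΛ : ∀ j X, X ∈ Λ j ↔ ValBound (α ^ (j + 1)) (ι X)) (hα : α ≠ 0) (hα1 : α < 1) (h2 : (2 : K) ≠ 0)
    (hc : ∀ X ∈ Λ 0, ((ρ (c X) : GL m K) : Matrix m m K) = cayley (ι X)) (hcc : ContinuousOn c (Λ 0 : Set V)) (hK0 : IsOpen (c '' (Λ 0 : Set V)))
    (hΛ' : ∀ j Z, Z ∈ Λ' j ↔ (pM Z ∈ Λ j ∧ pT Z ∈ Λ j)) (hsum : ∀ Z, pM Z + pT Z = Z) (hpMc : Continuous pM) (hpTc : Continuous pT)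
    (hshift : ∀ j, ∀ Z ∈ Λ (j + k), pM Z ∈ Λ j ∧ pT Z ∈ Λ j)
    (hΞ : ∀ Z ∈ Λ' k, ι (Ξ Z) = (1 - ι (pM Z))⁻¹ * (ι (pM Z) + ι (pT Z)) * (1 + ι (pM Z) * ι (pT Z))⁻¹ * (1 - ι (pM Z)))
    {κ : ℝ≥0∞} (hchart : ∀ B ⊆ (Λ 0 : Set V), MeasurableSet (c '' B) → κ * ν (c '' B) = μ B) {j : ℕ} (hj : k ≤ j) :
    κ * ν (c '' (Ξ '' ((Λ' k : Set V) ∩ pT ⁻¹' (Λ j : Set V)))) = μ ((Λ' k : Set V) ∩ pT ⁻¹' (Λ j : Set V)) := by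
  have hanti := level_antitone ι Λ hΛ hα1.le
  have hopenΛ := isOpen_level ι Λ hι.continuous hΛ hα
  have hopen := isOpen_window ι Λ ρ c pM pT Ξ hι hΛ hα hα1 h2 hc hcc hK0 hΛ' hsum hpMc hpTc hshift hΞ hj
  rw [hchart _ ?_ hopen.measurableSet]
  · exact measure_image_eq_of_newton Λ' Ξ μ (subBox_antitone hΛ' hanti) (isOpen_subBox hΛ' hopenΛ hshift)
      (isCompact_subBox hΛ' hopenΛ (isCompact_level ι Λ hι hΛ) hshift hsum k) (subBox_basis hΛ' hsum (exists_level_subset_of_mem_nhds ι Λ hι hΛ hα1))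
      (continuousOn_product ι Λ pM pT Ξ hι hΛ hα1 hΛ' hpMc hpTc hΞ) (product_newton ι Λ pM pT Ξ hΛ hα1 hΛ' hsum hshift hΞ)
      (by rw [product_zero ι pM pT Ξ hι.injective hΞ]; exact zero_mem _) inter_subset_left
      (isOpen_image_product ι Λ pM pT Ξ hι hΛ hα hα1 hΛ' hsum hpMc hpTc hshift hΞ hj).measurableSet
  · rintro _ ⟨Z, hZ, rfl⟩
    exact hanti (Nat.zero_le k) (product_mem_level ι Λ pM pT Ξ hΛ hα1 hΛ' hΞ hZ.1)

end Window

end Summit.HodgeConjecture.HodgeConjecture.Cruxes.H413.F0P3cStCharTSJacCartanWindow
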